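import Summits.SmoothPoincare4.SmoothPoincare4.Theses.VerlindeRLinks
import Literature.Topology.FourManifolds.KirbyMovesProofs
import Literature.Topology.FourManifolds.KirbyCalculusUnlinkProofs
import Literature.Topology.FourManifolds.LinkSurgeryExistence
import Literature.Topology.FourManifolds.KirbyMovesBlowDownProofs
import Literature.Topology.FourManifolds.RLinkSphere
import Literature.Barriers.SmoothPoincare4.PropertyTwoRAndrewsCurtisLink
import Summits.SmoothPoincare4.SmoothPoincare4.Theorems.VrlSlideGap.Negative.SmallComponentCounts
import Summits.SmoothPoincare4.SmoothPoincare4.Theorems.VrlSlideGap.Negative.BirthLineVersusSliceRigidity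
import HarnessLib.Audit

/-!
# Disproof of `VrlSliceRigidity` — findings (cdisprove, cycle 1, 2026-08-17)

Crux `Summit.SmoothPoincare4.SmoothPoincare4.Theses.VerlindeRLinks.VrlSliceRigidity`
(item stmt-SmoothPoincare4-16179), route `VerlindeRLinks`:

  `∀ [Knot.TubularNbhd.SmoothnessFacts] n (L : FramedLink (Fin n)) Y …,`
  `  IsSphereTwoProdCircleSum n Y → L.IsSurgery (𝓡 3) Y → (∀ i, (L.component i).IsSmoothlySlice) →`
  `  ∃ U, U.IsZeroFramedUnlink ∧ IsStrictHandleSlideEquivalent ⟨n, L⟩ ⟨n, U⟩`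

— the printed Generalised Property R conjecture (GST 2010 Conj. 1, strict 2-handle slides,
unstabilised) RESTRICTED to R-links whose components are smoothly slice in `B⁴`.

## Verdict of this cycle: NO KILL; the crux is false exactly modulo the Andrews–Curtis bet

* NO unconditional refutation is available: a counterexample is an R-link with slice components
  that resists strict slides; every candidate in print (GST's `L_{n,1}`, `n ≥ 3`; Meier–Zupan's
  generalized-square-knot families) resists certification because no strict-slide invariant finer
  than the linking matrix (which is `0` for every R-link) exists in the tree or in print — the
  route's own engine σ_p (D1) is unimplemented, and the Andrews–Curtis status of `AK(n)` is
  uncertified (GST §7: "presently no way to distinguish Andrews-Curtis equivalence classes";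
  LOSZ arXiv:2603.05664 §1: the GST/MZ links "have stubbornly resisted progress in either
  direction").  Typed loopholes checked and closed: `n = 0` (true, `U = L`), the
  `∀ [SmoothnessFacts]` binder (Prop-class, proof-irrelevant), `IsSphereTwoProdCircleSum`
  (honest `IsConnectedSum` gluing), `IsSurgery` (honest open gluing), `IsSmoothlySlice` (neat
  slice discs; the unknot is slice), `IsZeroFramedUnlink` (the `0`-framed unknot qualifies),
  corner-free `BandData` (wild bands change `L'` only up to isotopy, so the relation is the
  printed one extensionally).
* §3 (negative lemma modulo H; the implication was landed by the SIBLING crux-attack on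
  `VrlSlideGap`, `Theorems/VrlSlideGap/Negative/BirthLineVersusSliceRigidity.lean`, and is cited):
  the crux is FALSE modulo
  `SliceRigidityACObstruction := (GST slice R-link leaf, inline) ∧ AKPresentationsACNontrivial`
  — GST 2010 §7–§8 PRINT that `L_{n,1}` is an R-link, smoothly slice as a LINK ("Since the pictured
  4-manifold is actually diffeomorphic to a 4-ball [Go1], it follows that `L_{n,k}` is smoothly
  slice", §8 p. 18; "each component of `L_{n,k}` is ribbon", ibid.), and slide-trivial only if
  `⟨x, y ∣ yxy = xyx, xⁿ⁺¹ = yⁿ⟩` is Andrews–Curtis trivial (§7 p. 17); so the crux's ONLY lever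
  over printed GPRC — component sliceness — is satisfied by the Andrews–Curtis-suspicious family
  and evades nothing: `VrlSliceRigidity → ¬ AKPresentationsACNontrivial` modulo the printed leaf
  (sibling `not_akPresentationsACNontrivial_of_sliceRigidity`).  Any proof of the crux is a proof that
  every Akbulut–Kirby presentation `AK(n)`, `n ≥ 3`, is (unstably) Andrews–Curtis trivial.
* §2 (LANDED): load-bearing analysis.  Both R-link hypotheses are load-bearing already at `n = 1`,
  through the ONLY strict-slide invariant the tree affords, the framing of a one-component link
  (§1, landed by the sibling crux-attack in `VrlSlideGap/Negative/SmallComponentCounts.lean` and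
  cited: no slide is possible at `n = 1`, `IsStrictHandleSlide` needs `i ≠ j`; isotopy,
  renumbering and reversal keep the framing): the `1`-framed unknot is slice and is NOT strictly
  slide-equivalent to a `0`-framed unlink (`not_equiv_unknotOne_zeroFramed`), it has a connected
  surgery (blow-down to the empty link: `S³`), and `S² × S¹` is a `#¹(S² × S¹)` —
  `vrlSliceRigidity_false_without_isSurgery`, `vrlSliceRigidity_false_without_sphereSum`.
  Dropping the SLICE hypothesis instead gives back printed GPRC verbatim
  (`without_slice_iff_strictGPRC`, `Iff.rfl` up to the instance binder): open, not refutable here,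
  and the slice hypothesis is the only softening of the crux relative to GPRC.
* §4: relation to the summit.  `SmoothPoincare4 → VrlComponentsHBallSlice → VrlSlideGap → ¬ crux`
  (the route's `closes` read sideways): in GST's expected world (SPC4 true, GPRC false) the crux is
  false; a proof of the crux ∧ the support item proves `SPC4 → printed GPRC`.
* §5 `-- Targets` (line `sphere_split`, stubs `stub_sphereExists` / `stub_sliceSphereStandard` /
  `stub_stdSphereSlides`, restated verbatim since `Lines/*.lean` is not an importable module):
  no stub is killed.  `stub_stdSphereSlides` (GPRC on the standard sphere) carries the whole
  Andrews–Curtis content: FALSE modulo `gst2010_link_stdSphere_acTrivial_of_slides ∧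
  AKPresentationsACNontrivial` (`stub_stdSphereSlides_false_of`), Gompf 1991 printing that
  `Σ_{L_{n,1}}` is the standard `S⁴`.  `stub_sliceSphereStandard` is implied by `SmoothPoincare4`
  (via the PROVED `IsRLinkSphere.nonempty_homotopyEquiv_sphere_holds`), hence irrefutable short of
  an exotic sphere; WARNING for the lead: already its `n = 0` instance is Cerf's theorem `Γ₄ = 0`
  (every twisted sphere `D⁴ ∪_φ D⁴` is `S⁴`), because `IsRLinkSphere X L` quantifies over ALL
  gluing diffeomorphisms `φ : ∂(trace) ≅ ∂V` — budget accordingly (tree: Barriers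
  `TwistedSpheresStandard`).  `stub_sphereExists` is known (GST §9).
* §6 near-misses: none typed — every unconditional attack needs a certified slide-obstruction on
  a slice R-link, i.e. the route's cheapest falsifier σ₅(L_{3,1}) (D1) or an Andrews–Curtis
  certificate for AK(3); both are open computations with no implementation in the tree.

All theorems below are `sorry`-free; prose lives in docstrings.  Landed / proposed copies:
`Theorems/VrlSliceRigidity/Negative/LoadBearing.lean` (§2, p159210),
`Theorems/VrlSliceRigidity/Negative/FalseOfACObstruction.lean` (§3, negative-modulo H, p161485 ACCEPTED),
`Theorems/VrlSliceRigidity/Negative/Targets.lean` (§5, p159909).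
-/

noncomputable section

-- every `Summit.SmoothPoincare4.SmoothPoincare4.…` name repeats the summit = sub-problem segment
set_option linter.dupNamespace false

namespace Summit.SmoothPoincare4.SmoothPoincare4.Cruxes.VrlSliceRigidity.Disproof

open scoped Manifold ContDiff Topology
open Set Function Literature.Topology.FourManifolds
open Summit.SmoothPoincare4.SmoothPoincare4.Theses.VerlindeRLinks
  (VrlSliceRigidity VrlComponentsHBallSlice VrlSlideGap closes)
open Literature.Barriers.SmoothPoincare4
  (AKPresentationsACNontrivial gstPresentation gst2010_link_acTrivial_of_slides)

universe u

/-- Local notation: `𝔼 n` is the model Euclidean space `EuclideanSpace ℝ (Fin n)`. -/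
local notation "𝔼 " n:arg => EuclideanSpace ℝ (Fin n)

/-- Local notation: `𝕊 n` is the unit sphere in `EuclideanSpace ℝ (Fin (n + 1))`. -/
local notation "𝕊 " n:arg => (Metric.sphere (0 : EuclideanSpace ℝ (Fin (n + 1))) 1)

/-! ## §1 The `n = 1` framing rigidity — the one strict-slide invariant in the tree (CITED)

At `n = 1` no handle slide exists (`FramedLink.IsStrictHandleSlide` needs two distinct indices
`i ≠ j : Fin 1`), and the remaining moves (isotopy, renumbering, reversal) keep the framing; so the
framing of a one-component framed link is an invariant of `IsStrictHandleSlideEquivalent`.  This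
was LANDED by the sibling crux-attack on `VrlSlideGap`
(`Theorems/VrlSlideGap/Negative/SmallComponentCounts.lean`:
`framing_eq_of_isStrictHandleSlideEquivalent_one`, `not_equiv_zeroFramedUnlink_of_framing_ne_zero`)
and is USED here, not re-proved.  For `n ≥ 2` the linking matrix up to unimodular congruence is the
classical invariant, but it is `0` for every R-link (`H₁ = ℤⁿ`), which is WHY no abelian invariant
can ever refute the crux. -/

section FramingOne

variable [Knot.TubularNbhd.SmoothnessFacts]

open Summit.SmoothPoincare4.SmoothPoincare4.Theorems.VrlSlideGap.Negative
  (framing_eq_of_isStrictHandleSlideEquivalent_one not_equiv_zeroFramedUnlink_of_framing_ne_zero)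

/-- Framing rigidity at `n = 1` (sibling lemma, re-exported for the readers of this file):
strictly handle-slide equivalent one-component framed links have the same framing. [folklore] -/
theorem framing_eq_of_equiv_one {L L' : FramedLink (Fin 1)}
    (h : IsStrictHandleSlideEquivalent ⟨1, L⟩ ⟨1, L'⟩) : L.framing 0 = L'.framing 0 :=
  framing_eq_of_isStrictHandleSlideEquivalent_one h

/-- **The `1`-framed unknot is not strictly handle-slide equivalent to any `0`-framed unlink**
(sibling lemma `not_equiv_zeroFramedUnlink_of_framing_ne_zero` at framing `1 ≠ 0`).  This is the
witness behind both load-bearing lemmas of §2. [folklore] -/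
theorem not_equiv_unknotOne_zeroFramed {U : FramedLink (Fin 1)} (hU : U.IsZeroFramedUnlink) :
    ¬ IsStrictHandleSlideEquivalent ⟨1, FramedLink.single unknot 1⟩ ⟨1, U⟩ :=
  not_equiv_zeroFramedUnlink_of_framing_ne_zero (by simp) U hU

end FramingOne

/-- The `0`-framed unknot is a `0`-framed unlink (standard disc `unknotDisc`, PROVED smooth in the
tree: `isSmoothDisc_unknotDisc_holds`). [folklore] -/
theorem single_unknot_zero_isZeroFramedUnlink :
    (FramedLink.single unknot 0).IsZeroFramedUnlink :=
  ⟨⟨fun _ ↦ unknotDisc, fun _ ↦ ⟨isSmoothDisc_unknotDisc_holds, fun x ↦ unknotDisc_coe_sphere x⟩,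
    fun i j hij ↦ absurd (Subsingleton.elim i j) hij⟩, fun _ ↦ rfl⟩

/-- A surgery on the EMPTY framed link is connected (the link complement is all of `S³`, which is
connected, and its image covers `Y`). [folklore] -/
theorem connectedSpace_of_isSurgery_of_isEmpty {ι : Type*} [Finite ι] [IsEmpty ι]
    (L : FramedLink ι) {Y : Type*} [TopologicalSpace Y] [ChartedSpace (𝔼 3) Y]
    (h : L.IsSurgery (𝓡 3) Y) : ConnectedSpace Y := by
  obtain ⟨ν, -, -, jA, jB, hA, -, -, hcov, -, -⟩ := h
  have hsurj : Surjective jA := by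
    rw [← Set.range_eq_univ]
    simpa [Set.iUnion_of_empty] using hcov
  haveI : ConnectedSpace (𝕊 3) := connectedSpace_sphere_succ 2
  have hc : IsConnected (L.toLink.complement : Set (𝕊 3)) := by
    have : (L.toLink.complement : Set (𝕊 3)) = univ :=
      Set.eq_univ_of_forall fun x ↦ (Link.mem_complement_iff _ _).2 fun i ↦ isEmptyElim i
    rw [this]
    exact isConnected_univ
  haveI : ConnectedSpace L.toLink.complement := isConnected_iff_connectedSpace.1 hc
  exact hsurj.connectedSpace hA.isEmbedding.continuous

/-- **Every surgery on the `1`-framed unknot is connected**: blow the split `+1`-framed unknot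
down (`FramedLink.IsBlowDown.isSurgery_holds`, PROVED) — the same `Y` is a surgery on the empty
link, i.e. an image of `S³`.  (On paper `Y ≅ S³`; connectedness is all §2 needs.) [folklore] -/
theorem connectedSpace_of_isSurgery_unknot_one [Knot.TubularNbhd.SmoothnessFacts] {Y : Type}
    [TopologicalSpace Y] [T2Space Y] [SecondCountableTopology Y] [ChartedSpace (𝔼 3) Y]
    [IsManifold (𝓡 3) ∞ Y] (hL : (FramedLink.single unknot 1).IsSurgery (𝓡 3) Y) :
    ConnectedSpace Y := by
  have hBD : FramedLink.IsBlowDown 1 ((FramedLink.single unknot (1 : ℤ)).reindex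
      (finSuccEquiv 0).symm) FramedLink.empty :=
    ⟨fun i ↦ i.elim0, rfl, unknotDisc, isSmoothDisc_unknotDisc_holds, unknotDisc_coe_sphere,
      fun i ↦ i.elim0⟩
  have hL' : ((FramedLink.single unknot (1 : ℤ)).reindex (finSuccEquiv 0).symm).IsSurgery
      (𝓡 3) Y :=
    (FramedLink.isSurgery_reindex_iff_holds _ _).2 hL
  exact connectedSpace_of_isSurgery_of_isEmpty FramedLink.empty
    (FramedLink.IsBlowDown.isSurgery_holds hBD hL')

/-! ## §2 Load-bearing analysis — `def VrlSliceRigidityWithout<H>` + `¬` (all PROVED)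

Hypotheses of the crux: (H₁) `IsSphereTwoProdCircleSum n Y`, (H₂) `L.IsSurgery (𝓡 3) Y`,
(H₃) `∀ i, (L.component i).IsSmoothlySlice`.  (H₁) and (H₂) are each load-bearing at `n = 1`
(the `1`-framed unknot); (H₃) dropped is printed GPRC (open). -/

/-- The crux WITHOUT the surgery hypothesis (H₂) `L.IsSurgery (𝓡 3) Y`. -/
def VrlSliceRigidityWithoutIsSurgery : Prop :=
  ∀ [Knot.TubularNbhd.SmoothnessFacts] (n : ℕ) (L : FramedLink (Fin n)) (Y : Type)
    [TopologicalSpace Y] [T2Space Y] [SecondCountableTopology Y] [ChartedSpace (𝔼 3) Y]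
    [IsManifold (𝓡 3) ∞ Y] [CompactSpace Y] [ConnectedSpace Y],
    IsSphereTwoProdCircleSum n Y → (∀ i : Fin n, (L.component i).IsSmoothlySlice) →
      ∃ U : FramedLink (Fin n), U.IsZeroFramedUnlink ∧ IsStrictHandleSlideEquivalent ⟨n, L⟩ ⟨n, U⟩

/-- **(H₂) is load-bearing**: without `L.IsSurgery (𝓡 3) Y` the crux fails at `n = 1` — take
`L` the `1`-framed unknot (slice) and `Y ≅ S² × S¹ = #¹(S² × S¹)` (the PROVED surgery on the
`0`-framed unknot, `exists_isSurgery_zeroFramedUnlink_holds`); `L` is not strictly slide-equivalent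
to a `0`-framed unlink by framing rigidity.  Any proof of the crux must use that `Y` is surgery ON
`L` (on paper: to force framing `0` and, at `n = 1`, Gabai's Property R). [folklore] -/
theorem vrlSliceRigidity_false_without_isSurgery [Knot.TubularNbhd.SmoothnessFacts] :
    ¬ VrlSliceRigidityWithoutIsSurgery := by
  intro h
  obtain ⟨Y, _, _, _, _, _, _, _, hY, -⟩ :=
    exists_isSurgery_zeroFramedUnlink_holds (FramedLink.single unknot 0)
      single_unknot_zero_isZeroFramedUnlink
  obtain ⟨U, hU, hLU⟩ :=
    @h ‹_› 1 (FramedLink.single unknot 1) Y _ _ _ _ _ _ _ hY (fun _ ↦ isSmoothlySlice_unknot)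
  exact not_equiv_unknotOne_zeroFramed hU hLU

/-- The crux WITHOUT the sphere-sum hypothesis (H₁) `IsSphereTwoProdCircleSum n Y`. -/
def VrlSliceRigidityWithoutSphereSum : Prop :=
  ∀ [Knot.TubularNbhd.SmoothnessFacts] (n : ℕ) (L : FramedLink (Fin n)) (Y : Type)
    [TopologicalSpace Y] [T2Space Y] [SecondCountableTopology Y] [ChartedSpace (𝔼 3) Y]
    [IsManifold (𝓡 3) ∞ Y] [CompactSpace Y] [ConnectedSpace Y],
    L.IsSurgery (𝓡 3) Y → (∀ i : Fin n, (L.component i).IsSmoothlySlice) →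
      ∃ U : FramedLink (Fin n), U.IsZeroFramedUnlink ∧ IsStrictHandleSlideEquivalent ⟨n, L⟩ ⟨n, U⟩

/-- **(H₁) is load-bearing**: without `Y ≅ #ⁿ(S² × S¹)` the crux fails at `n = 1` — the
`1`-framed unknot is slice, has a (connected, closed) surgery `Y` (PROVED existence of surgery,
`FramedLink.exists_isSurgery_holds`; connected by `connectedSpace_of_isSurgery_unknot_one`; on
paper `Y = S³`), and is not strictly slide-equivalent to a `0`-framed unlink.  Any proof of the
crux must use `H₁(Y) = ℤⁿ` (on paper: the linking matrix of an R-link vanishes, GST Prop. 2.2 —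
line `birth`'s `stub_framingZero`). [folklore] -/
theorem vrlSliceRigidity_false_without_sphereSum [Knot.TubularNbhd.SmoothnessFacts] :
    ¬ VrlSliceRigidityWithoutSphereSum := by
  intro h
  obtain ⟨Y, _, _, _, _, _, _, hL⟩ := FramedLink.exists_isSurgery_holds (FramedLink.single unknot 1)
  haveI : ConnectedSpace Y := connectedSpace_of_isSurgery_unknot_one hL
  obtain ⟨U, hU, hLU⟩ :=
    @h ‹_› 1 (FramedLink.single unknot 1) Y _ _ _ _ _ _ _ hL (fun _ ↦ isSmoothlySlice_unknot)
  exact not_equiv_unknotOne_zeroFramed hU hLU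

/-- The crux WITHOUT the slice hypothesis (H₃). -/
def VrlSliceRigidityWithoutSlice : Prop :=
  ∀ [Knot.TubularNbhd.SmoothnessFacts] (n : ℕ) (L : FramedLink (Fin n)) (Y : Type)
    [TopologicalSpace Y] [T2Space Y] [SecondCountableTopology Y] [ChartedSpace (𝔼 3) Y]
    [IsManifold (𝓡 3) ∞ Y] [CompactSpace Y] [ConnectedSpace Y],
    IsSphereTwoProdCircleSum n Y → L.IsSurgery (𝓡 3) Y →
      ∃ U : FramedLink (Fin n), U.IsZeroFramedUnlink ∧ IsStrictHandleSlideEquivalent ⟨n, L⟩ ⟨n, U⟩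

/-- **(H₃) dropped = printed GPRC, verbatim** (GST 2010 Conj. 1 over strict slides, the tree's
`StrictGeneralizedPropertyRConjecture`, under the same instance binder): NOT refutable here (open;
GST "probably false"), and it shows the slice hypothesis is the crux's only softening. [folklore] -/
theorem without_slice_iff_strictGPRC :
    VrlSliceRigidityWithoutSlice ↔
      ∀ [Knot.TubularNbhd.SmoothnessFacts], StrictGeneralizedPropertyRConjecture :=
  Iff.rfl

/-- Printed GPRC implies the crux (restriction), for the record. [folklore] -/
theorem vrlSliceRigidity_of_strictGPRC
    (h : ∀ [Knot.TubularNbhd.SmoothnessFacts], StrictGeneralizedPropertyRConjecture) :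
    VrlSliceRigidity :=
  fun n L Y _ _ _ _ _ _ _ hY hL _ ↦ h n L Y hY hL

/-! ## §3 The Andrews–Curtis axis — the crux is FALSE modulo `SliceRigidityACObstruction`

The implication itself — GST's slice R-link leaf ∧ `AKPresentationsACNontrivial` ⊢ ¬ crux — was
LANDED by the sibling crux-attack (`Theorems/VrlSlideGap/Negative/BirthLineVersusSliceRigidity.lean`:
`VrlSliceRigidity_false_of_acNontrivial`, `not_akPresentationsACNontrivial_of_sliceRigidity`) and
is CITED here.  This cycle packages it over ONE hypothesis `H` (LANDED, p161485 accepted 2026-08-17,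
`Theorems/VrlSliceRigidity/Negative/FalseOfACObstruction.lean`, `--negative-modulo
SliceRigidityACObstruction` with `H` an `@[conjecture] def` inside that file — an inline plain
`def` is relocated to Literature and refused as `literature.conjecture`, and refuters cannot file
stand-alone obligation nodes; filing history in `Cruxes/VrlSliceRigidity/AC-OBSTRUCTION.md`) and
verifies the printed sources:
GST 2010 §8, arXiv p. 18: "Since the pictured 4-manifold is actually diffeomorphic to a 4-ball
[Go1], it follows that `L_{n,k}` is smoothly slice"; "each component of `L_{n,k}` is ribbon"; §7
p. 17: "If the 2-component link `L_{n,k}` … can be changed to the unlink by handle slides, then the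
dual slides … will trivialize that picture, showing that the above presentation is Andrews-Curtis
trivial."  So the crux's ONLY lever over printed GPRC (component sliceness) is met by the
Andrews–Curtis-suspicious family and evades nothing. -/

section AC

variable [Knot.TubularNbhd.SmoothnessFacts]

open Summit.SmoothPoincare4.SmoothPoincare4.Theorems.VrlSlideGap.Negative
  (VrlSliceRigidity_false_of_acNontrivial not_akPresentationsACNontrivial_of_sliceRigidity)

/-- **`H` — the Andrews–Curtis obstruction datum for slice rigidity** (verbatim the landed
`Theorems/VrlSliceRigidity/Negative/FalseOfACObstruction.lean`): GST's slice R-link leaf — for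
every `n` an R-link `L : FramedLink (Fin 2)` (GST's `L_{n,1} = Q ⊔ Vₙ`) with smoothly slice
components whose strict slide-triviality forces Andrews–Curtis triviality of `gstPresentation n`
(printed: GST 2010 §7 p. 17, §8 p. 18, [Go1] = Gompf 1991; constructible in principle, XL) — AND
`AKPresentationsACNontrivial` (OPEN, "deemed likely"; the unconstructible conjunct: GST §7 "no way
to distinguish Andrews-Curtis equivalence classes"; AK(3) only STABLY trivial, arXiv:2501.18601).
[cite: GompfScharlemannThompson2010, §7 (arXiv p. 17) and §8 (arXiv p. 18)] [cite: Gompf1991Killing] -/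
def SliceRigidityACObstruction : Prop :=
  (∀ n : ℕ, ∃ L : FramedLink (Fin 2),
      (∃ (Y : Type) (_ : TopologicalSpace Y) (_ : T2Space Y) (_ : SecondCountableTopology Y)
          (_ : ChartedSpace (𝔼 3) Y) (_ : IsManifold (𝓡 3) ∞ Y)
          (_ : CompactSpace Y) (_ : ConnectedSpace Y),
          IsSphereTwoProdCircleSum 2 Y ∧ L.IsSurgery (𝓡 3) Y) ∧
      (∀ i : Fin 2, (L.component i).IsSmoothlySlice) ∧
      ∀ U : FramedLink (Fin 2), U.IsZeroFramedUnlink →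
        IsStrictHandleSlideEquivalent ⟨2, L⟩ ⟨2, U⟩ →
          IsAndrewsCurtisEquivalent (gstPresentation n) (BalancedPresentation.trivial 2)) ∧
    AKPresentationsACNontrivial

/-- **`VrlSliceRigidity` is false modulo `SliceRigidityACObstruction`** (sibling theorem
`VrlSliceRigidity_false_of_acNontrivial` over the single hypothesis `H`): apply the crux to GST's
`L_{n,1}` to slide it to a `0`-framed unlink, making `gstPresentation n` Andrews–Curtis trivial.
[cite: GompfScharlemannThompson2010, §7–§8] -/
theorem VrlSliceRigidity_false_of_SliceRigidityACObstruction :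
    SliceRigidityACObstruction → ¬ VrlSliceRigidity :=
  fun h ↦ VrlSliceRigidity_false_of_acNontrivial h.1 h.2

/-- The first conjunct of `H` refines the catalogue leaf `gst2010_link_acTrivial_of_slides`
(forget sliceness), tying `H` to the barrier `StrictPropertyTwoRBarrier`.
[cite: GompfScharlemannThompson2010, §7] -/
theorem gst2010_link_acTrivial_of_slides_of_obstruction (h : SliceRigidityACObstruction) :
    gst2010_link_acTrivial_of_slides := fun n ↦ by
  obtain ⟨L, hY, -, hAC⟩ := h.1 n
  exact ⟨L, hY, hAC⟩

/-- Contrapositive (sibling theorem, re-exported): modulo the printed GST leaf, **a proof of the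
crux proves that every `⟨x, y ∣ yxy = xyx, xⁿ⁺¹ = yⁿ⟩` (`n ≥ 3`) is Andrews–Curtis trivial**.
[cite: GompfScharlemannThompson2010, §7] -/
theorem not_acNontrivial_of_crux (h : SliceRigidityACObstruction) (hC : VrlSliceRigidity) : False :=
  not_akPresentationsACNontrivial_of_sliceRigidity h.1 hC h.2

end AC

/-! ## §4 Relation to the summit (the route's `closes` read sideways; workfile only) -/

/-- **In GST's expected world the crux is false**: `SmoothPoincare4`, the support item
`VrlComponentsHBallSlice` and the slide gap (`VrlSlideGap` = ¬ printed GPRC up to the instance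
conjunct) together refute `VrlSliceRigidity` — this is `closes` with the conclusion moved.  So the
crux ∧ the (true-on-paper) support item prove `SmoothPoincare4 → ¬ VrlSlideGap`, i.e. SPC4 ⇒
printed GPRC.  Deliberately an `example` (no negative edge enters the environment). [folklore] -/
example (hS : _root_.SmoothPoincare4) (h₃ : VrlComponentsHBallSlice) (hgap : VrlSlideGap) :
    ¬ VrlSliceRigidity :=
  fun h₂ ↦ closes hgap h₂ h₃ hS

/-! ## §5 Targets — line `sphere_split` (picked 2026-08-17; stubs restated VERBATIM from
`Cruxes/VrlSliceRigidity/Lines/sphere_split.lean`, which is not an importable module)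

* `stub_sphereExists` — KNOWN (GST §9); not attacked.
* `stub_sliceSphereStandard` — implied by `SmoothPoincare4` (PROVED homotopy-sphere fact): any kill
  is an exotic `S⁴`.  Its `n = 0` instance is Cerf's `Γ₄ = 0` (twisted spheres), see the module
  docstring — a cost warning, not a kill.
* `stub_stdSphereSlides` — the heart; FALSE modulo `gst2010_link_stdSphere_acTrivial_of_slides ∧
  AKPresentationsACNontrivial` (below).  Joint sufficiency of the three stubs is a real proof
  (`VrlSliceRigidity_of` in the line file); nothing to attack there. -/

namespace Target

/-- VERBATIM copy of `SphereSplit.Sig.stub_stdSphereSlides` (GPRC on the standard sphere). -/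
def stub_stdSphereSlides : Prop :=
  ∀ [Knot.TubularNbhd.SmoothnessFacts] (n : ℕ) (L : FramedLink (Fin n)) (Y : Type)
    [TopologicalSpace Y] [T2Space Y] [SecondCountableTopology Y]
    [ChartedSpace (𝔼 3) Y] [IsManifold (𝓡 3) ∞ Y] [CompactSpace Y] [ConnectedSpace Y],
    IsSphereTwoProdCircleSum n Y → L.IsSurgery (𝓡 3) Y →
      ∀ (X : Type) [TopologicalSpace X] [T2Space X] [SecondCountableTopology X]
        [ChartedSpace (𝔼 4) X] [IsManifold (𝓡 4) ∞ X],
        IsRLinkSphere X L → Nonempty (X ≃ₘ⟮𝓡 4, 𝓡 4⟯ 𝕊 4) →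
          ∃ U : FramedLink (Fin n), U.IsZeroFramedUnlink ∧ IsStrictHandleSlideEquivalent ⟨n, L⟩ ⟨n, U⟩

/-- VERBATIM copy of `SphereSplit.Sig.stub_sliceSphereStandard`. -/
def stub_sliceSphereStandard : Prop :=
  ∀ (n : ℕ) (L : FramedLink (Fin n)) (Y : Type) [TopologicalSpace Y] [T2Space Y]
    [SecondCountableTopology Y] [ChartedSpace (𝔼 3) Y] [IsManifold (𝓡 3) ∞ Y]
    [CompactSpace Y] [ConnectedSpace Y],
    IsSphereTwoProdCircleSum n Y → L.IsSurgery (𝓡 3) Y →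
      (∀ i : Fin n, (L.component i).IsSmoothlySlice) →
        ∀ (X : Type) [TopologicalSpace X] [T2Space X] [SecondCountableTopology X]
          [ChartedSpace (𝔼 4) X] [IsManifold (𝓡 4) ∞ X],
          IsRLinkSphere X L → Nonempty (X ≃ₘ⟮𝓡 4, 𝓡 4⟯ 𝕊 4)

/-- `stub_sliceSphereStandard` restricted to `n = 0` already says: EVERY closed manifold of the
empty R-link — i.e. every twisted sphere `X = P ∪_φ V` with `P` a trace of `∅` (a `4`-ball), `V` a
`(1,0)`-handlebody (a `4`-ball) and `φ` ANY diffeomorphism of the boundary `3`-spheres — is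
diffeomorphic to `S⁴`.  On paper this is Cerf's theorem `Γ₄ = 0` (1968); recorded as the typed
statement the lead must budget for (no kill: it is TRUE). [cite: Kirby1989, Ch. I §2] -/
def stub_sliceSphereStandard_zero : Prop :=
  ∀ (X : Type) [TopologicalSpace X] [T2Space X] [SecondCountableTopology X]
    [ChartedSpace (𝔼 4) X] [IsManifold (𝓡 4) ∞ X],
    IsRLinkSphere X FramedLink.empty → Nonempty (X ≃ₘ⟮𝓡 4, 𝓡 4⟯ 𝕊 4)

/-- The `n = 0` slice of stub 1 follows from stub 1 (apply it to the empty link and `Y = S³`,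
the PROVED surgery on the empty link `FramedLink.isSurgery_sphereThree_of_isEmpty`). [folklore] -/
theorem stub_sliceSphereStandard_zero_of (h : stub_sliceSphereStandard) :
    stub_sliceSphereStandard_zero := by
  intro X _ _ _ _ _ hX
  haveI : ConnectedSpace (𝕊 3) := connectedSpace_sphere_succ 2
  exact h 0 FramedLink.empty (𝕊 3) ⟨Diffeomorph.refl _ _ _⟩
    (FramedLink.isSurgery_sphereThree_of_isEmpty _) (fun i ↦ i.elim0) X hX

variable [Knot.TubularNbhd.SmoothnessFacts]

/-- **GST's link with STANDARD sphere** (GST 2010 §7 + [Go1] = Gompf 1991, *Killing the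
Akbulut–Kirby 4-sphere*): `L_{n,1}` is an R-link whose closed `1`-handle-free manifold `Σ_{L_{n,1}}`
(some `X` with `IsRLinkSphere X L`) is DIFFEOMORPHIC to `S⁴` ("the pictured 4-manifold is
actually diffeomorphic to a 4-ball [Go1]", §8 p. 18; closing the ball by the `(1,2)`-dual picture
is `S⁴`, §7), and strict slide-triviality of `L_{n,1}` forces Andrews–Curtis triviality of
`gstPresentation n` (§7 p. 17).  Inline named fact (stub-level sibling of
the first conjunct of `SliceRigidityACObstruction`); discharge needs `L_{n,1}`, its trace and Gompf's
diffeomorphism — XL. [cite: GompfScharlemannThompson2010, §7, §8 p. 18] [cite: Gompf1991Killing] -/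
def gst2010_link_stdSphere_acTrivial_of_slides : Prop :=
  ∀ n : ℕ, ∃ L : FramedLink (Fin 2),
    (∃ (Y : Type) (_ : TopologicalSpace Y) (_ : T2Space Y) (_ : SecondCountableTopology Y)
        (_ : ChartedSpace (𝔼 3) Y) (_ : IsManifold (𝓡 3) ∞ Y) (_ : CompactSpace Y)
        (_ : ConnectedSpace Y), IsSphereTwoProdCircleSum 2 Y ∧ L.IsSurgery (𝓡 3) Y) ∧
    (∃ (X : Type) (_ : TopologicalSpace X) (_ : T2Space X) (_ : SecondCountableTopology X)
        (_ : ChartedSpace (𝔼 4) X) (_ : IsManifold (𝓡 4) ∞ X),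
        IsRLinkSphere X L ∧ Nonempty (X ≃ₘ⟮𝓡 4, 𝓡 4⟯ 𝕊 4)) ∧
    ∀ U : FramedLink (Fin 2), U.IsZeroFramedUnlink →
      IsStrictHandleSlideEquivalent ⟨2, L⟩ ⟨2, U⟩ →
        IsAndrewsCurtisEquivalent (gstPresentation n) (BalancedPresentation.trivial 2)

/-- **The heart stub is false modulo (GST standard-sphere leaf ∧ AC nontriviality)**: the stub
applied to `L_{n,1}` and Gompf's `Σ_{L_{n,1}} ≅ S⁴` slides `L_{n,1}` to the unlink, making
`gstPresentation n` Andrews–Curtis trivial.  So `stub_stdSphereSlides` carries the ENTIRE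
Andrews–Curtis content of the crux, unconditionally located (no open §8 ribbon question involved).
[cite: GompfScharlemannThompson2010, §7] -/
theorem stub_stdSphereSlides_false_of (hGo : gst2010_link_stdSphere_acTrivial_of_slides)
    (hAC : AKPresentationsACNontrivial) : ¬ stub_stdSphereSlides := by
  rintro h2
  obtain ⟨n, -, hnot⟩ := hAC
  obtain ⟨L, ⟨Y, _, _, _, _, _, _, _, hY, hL⟩, ⟨X, _, _, _, _, _, hX, hstd⟩, hACtriv⟩ := hGo n
  obtain ⟨U, hU, hLU⟩ := @h2 ‹_› 2 L Y _ _ _ _ _ _ _ hY hL X _ _ _ _ _ hX hstd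
  exact hnot (hACtriv U hU hLU)

end Target

/-! ## §6 Near-misses / why it resists (no `sorry` needed — nothing typed came close)

* A genuine counterexample needs a CERTIFIED obstruction to strict slides on a slice R-link.  The
  only invariants of `IsStrictHandleSlideEquivalent` available are abelian (§1: framings at
  `n = 1`; linking matrix up to congruence in general), and they vanish identically on R-links.
  Non-abelian candidates — the route's σ_p (Décoppet–Haïoun, D1), Kerler–Lyubashenko `J₄` of the
  dual 2-handlebody (arXiv:2105.02789), an Andrews–Curtis certificate for `AK(3)` — are
  unimplemented / open; `kit` has nothing to run (the route's VrlComputePlan is a definition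
  request).  Bound of the counterexample search: none possible beyond `n ≤ 1` (where the crux is
  TRUE: `n = 0` by `U = L`, `n = 1` = Gabai's Property R for slice knots, framing forced `0`).
* Junk/degenerate models: all closed (module docstring).  Hypothesis mutation: §2.
* What would change the verdict: (a) D1 implemented and σ₅(L_{3,1}) ≠ 1 ⇒ unconditional
  `¬ VrlSliceRigidity` (and the route's intended bridge dies with it); (b) a Lean construction of
  `L_{3,1}` with its surgery + any certified slide obstruction; (c) conversely, unstable
  AC-trivialisation of all `AK(n)` would remove the only known reason to doubt the crux. -/

end Summit.SmoothPoincare4.SmoothPoincare4.Cruxes.VrlSliceRigidity.Disproof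

end
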